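import Literature.Analysis.FluidPDE.SereginSverakIteration
import HarnessLib

/-!
# Seregin–Šverák 2009, Lemma 3.5: the scaled energy bound, its printed inputs and its iteration

G. Seregin, V. Šverák, *On Type I singularities of the local axi-symmetric solutions of the
Navier–Stokes equations*, Comm. PDE 34 (2009), 171–201 = arXiv:0804.1803 (page and label
references are to the arXiv version). Lemma 3.5 (label asl4, arXiv p. 9) is vendored in the
accepted file `SereginSverakAxisymmetric.lean` as the named fact
`SereginSverak2009.ScaledEnergyBound`: under the hypotheses of Thm. 3.1 (standing assumptions,
axial symmetry, Type I bound), `A + E + C + D ≤ C₁` at all centres `z_b = (b e₃, 0)`,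
`|b| ≤ 1/4`, and radii `0 < r < 1/4`, `E` computed through a weak spatial gradient `∇v` on `Q`.

The printed proof (arXiv pp. 9–10) has four ANALYTIC INPUTS and an ELEMENTARY ITERATION:

* (as6) `A(0, 3/4; v) + E(0, 3/4; v) ≤ C₂ < +∞` "by Lemma 3.3 and by Remark 3.4" (Remark 3.4:
  under the standing assumptions, axial symmetry and (r2), `(v, q)` is a suitable weak solution
  in `Q` in the sense of their Def. 2.2, `v ∈ L_{2,∞}(Q) ∩ W^{1,0}_2(Q)`; (r2) follows from the
  Type I bound (r3)); together with (as7), the swirl bound `|x'| |v_φ| ≤ C₂` on `Q(1/2)` of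
  Lemma 3.3 (App. II, Moser iteration);
* (as11) `C(z_b, r; v) ≤ ε (E(z_b, r; v) + A(z_b, r; v)) + f₁(ε, C, C₂)` for every `ε > 0` and
  all `z_b`, `r` as in (as5) — obtained from the multiplicative inequality (as2) of
  Seregin–Zajaczkowski [S10] applied to `v̂ = v_φ e_φ` with (as7) ((as8)) and to
  `v̄ = v_ϱ e_ϱ + v₃ e₃` with (r3) ((as9)), and Young's inequality ((as10));
* (as12) the local energy inequality
  `E(z_b, r/2; v) + A(z_b, r/2; v) ≤ c (C^{2/3}(z_b, r; v) + C(z_b, r; v) + D(z_b, r; q))`;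
* (as13) the decay estimate for the pressure
  `D(z_b, ϱ; q) ≤ c [ (ϱ/r) D(z_b, r; q) + (r/ϱ)² C(z_b, r; v) ]`, `0 < ϱ ≤ r`;
* the iteration ("The rest of the proof is routine", p. 10): with `ℰ(r) = E + A + D` at `z_b`,
  (as12) at radius `2ϑr`, (as13) at `ϱ = ϑ r` and `ϱ = 2ϑ r`, the scaling
  `C(z_b, 2ϑr) ≤ (2ϑ)⁻² C(z_b, r)` and (as11) give
  `ℰ(ϑ r) ≤ c (ϑ + ε/ϑ²) ℰ(r) + f₂`; choosing `ϑ` then `ε` makes this `ℰ(ϑr) ≤ ½ ℰ(r) + f₃`,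
  which iterates down from the scales `r ∼ 1/4` — where `ℰ` is controlled by (as6) and
  `‖q‖_{L^{3/2}(Q)}` through the inclusions `Q(z_b, r) ⊆ Q(0, 3/4)` — to every `0 < r < 1/4`;
  finally `C` is bounded by (as11).

None of the four inputs is within reach of Mathlib or the tree today (no parabolic Sobolev
classes, no Gagliardo–Nirenberg inequality on cylinders, no interior regularity for the Stokes
system, no harmonic/Calderón–Zygmund decomposition of the pressure). This file therefore
DECOMPOSES Lemma 3.5 along the printed proof:

* the inputs are vendored as named facts, each with the paper's display label —
  `SereginSverak2009.GradientEnergyBound` ((as6)), `SereginSverak2009.CubicAbsorption` ((as11)),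
  `SereginSverak2009.LocalEnergyEstimate` ((as12)), `SereginSverak2009.PressureDecay` ((as13));
* the iteration is PROVED: `SereginSverak2009.ScaledEnergyBound.of_inputs :
  GradientEnergyBound → CubicAbsorption → LocalEnergyEstimate → PressureDecay → ScaledEnergyBound`,
  through the abstract `ℝ≥0∞`-valued scheme of the companion file
  `SereginSverakIteration.lean` (`SereginSverak2009.decay_step`, `decay_step_half`,
  `iterate_halving`) and the monotonicity of the functionals `A, E, C, D` in the cylinder
  (`…_le_of_subset`, ibid.).

Discharging `ScaledEnergyBound` (`ScaledEnergyBound_holds`) is thereby reduced to discharging the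
four inputs.

## Rendering choices

* All four inputs are stated, as printed, in the context of the proof of Lemma 3.5: "under
  assumptions of Theorem 3.1" (`IsAxisymmetricLocalSolution u p ∧ IsTypeIOnCyl u`), for the
  centres and radii of (as5). (as11)–(as12) involve `E`, i.e. `∇v`; they are stated for every
  weak spatial gradient `G` of `u` on `Q` (`HasWeakSpatialGradientOn`, accepted), which is
  harmless since two weak gradients agree a.e. on `Q` and `E` only integrates `G` over subsets of
  `Q`. (as6) PROVIDES such a `G` (this is where Remark 3.4 enters). When `E` or `A` is infinite
  the inequalities (as11)–(as12) are trivially true, so no finiteness proviso is needed.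
* The generic constants `c` of (as12)–(as13) are universal (`∃ c` before the solution), as in
  the paper's convention; `f₁` of (as11) depends on `ε` and on the solution (through `C`, `C₂`),
  rendered as `∃ F` after `u, p, G, ε`. Constants are `ℝ≥0`, functionals `ℝ≥0∞` (accepted
  `energyA`, `dissipationE`, `cubicC`, `pressureD`), ratios `ϱ/r`, `(r/ϱ)²` enter through
  `ENNReal.ofReal`.
* (as6) is rendered as finiteness `A(0,3/4) + E(0,3/4) < ∞` (`≤ C₂ < +∞` in print); the swirl
  bound (as7) is not needed once (as11) is an input and is not restated here.
* The uniform dependence of `C₁` on `C, ‖v‖₃, ‖q‖_{3/2}` is dropped in `ScaledEnergyBound`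
  (accepted rendering), so the proof below only tracks finiteness.

## References

* G. Seregin, V. Šverák, Comm. PDE 34 (2009), 171–201, arXiv:0804.1803: §2 Def. 2.2 (p. 6),
  §3 Lemma 3.3, Remark 3.4, (as2)–(as3), Lemma 3.5 and its proof (as4)–(as13) (pp. 9–10).
  [`SereginSverak2009`]
* G. Seregin, W. Zajaczkowski, *A sufficient condition of local regularity for the
  Navier–Stokes equations*, Zap. Nauchn. Sem. POMI 336 (2006), 46–54 (the paper's [S10], source
  of (as2)).
-/

noncomputable section

open MeasureTheory Set Function Filter Topology TopologicalSpace
open scoped NNReal ENNReal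

namespace Literature.Analysis.FluidPDE

namespace SereginSverak2009

/-- Local notation for physical space `ℝ³ = EuclideanSpace ℝ (Fin 3)`. -/
local notation "ℝ³" => EuclideanSpace ℝ (Fin 3)

/-! ### The four analytic inputs of the printed proof, as named facts -/

/-- **Seregin–Šverák 2009, proof of Lemma 3.5, (as6)** (arXiv p. 9: "By Lemma 3.3 and by
Remark 3.4, we have … `A(0, 3/4; v) + E(0, 3/4; v) ≤ C₂ < +∞`"). Under the assumptions of
Thm. 3.1, `v` has a weak spatial gradient `∇v = G` on `Q` (Remark 3.4: `(v, q)` is a suitable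
weak solution in `Q`, `v ∈ L_{2,∞}(Q) ∩ W^{1,0}_2(Q)`, Def. 2.2) and the scaled energy and
dissipation on `Q(3/4)` are finite.
[cite: SereginSverak2009, proof of Lemma 3.5, (as6), with Remark 3.4] -/
def GradientEnergyBound : Prop :=
  ∀ (u : ℝ → ℝ³ → ℝ³) (p : ℝ → ℝ³ → ℝ), IsAxisymmetricLocalSolution u p → IsTypeIOnCyl u →
    ∃ G : ℝ → ℝ³ → ℝ³ →L[ℝ] ℝ³, HasWeakSpatialGradientOn (parCylOpens 0 1) u G ∧
      energyA 0 (3 / 4) u + dissipationE 0 (3 / 4) G < ∞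

/-- **Seregin–Šverák 2009, proof of Lemma 3.5, (as11)** (arXiv p. 10: "Applying Young's
inequality in (as10), we arrive at the important estimate
`C(z_b, r; v) ≤ ε (E(z_b, r; v) + A(z_b, r; v)) + f₁(ε, C, C₂)` provided conditions (as5) hold.
In (as11), the positive number `ε` is a parameter to pick up later"; (as10) comes from the
multiplicative inequality (as2) of [S10] applied to `v̂` with the swirl bound (as7) and to `v̄`
with the Type I bound (r3)). Under the assumptions of Thm. 3.1, for every weak spatial gradient
`G` of `u` on `Q` and every `ε > 0` there is `F` with `C ≤ ε (E + A) + F` at all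
`z_b = (b e₃, 0)`, `|b| ≤ 1/4`, `0 < r < 1/4`.
[cite: SereginSverak2009, proof of Lemma 3.5, (as11)] -/
def CubicAbsorption : Prop :=
  ∀ (u : ℝ → ℝ³ → ℝ³) (p : ℝ → ℝ³ → ℝ), IsAxisymmetricLocalSolution u p → IsTypeIOnCyl u →
    ∀ G : ℝ → ℝ³ → ℝ³ →L[ℝ] ℝ³, HasWeakSpatialGradientOn (parCylOpens 0 1) u G →
      ∀ ε : ℝ≥0, 0 < ε → ∃ F : ℝ≥0, ∀ b : ℝ, |b| ≤ 1 / 4 → ∀ r ∈ Ioo (0 : ℝ) (1 / 4),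
        cubicC ((0 : ℝ), b • eZ) r u ≤
          ε * (dissipationE ((0 : ℝ), b • eZ) r G + energyA ((0 : ℝ), b • eZ) r u) + F

/-- **Seregin–Šverák 2009, proof of Lemma 3.5, (as12)** (arXiv p. 10: "we consider the local
energy inequality `E(z_b, r/2; v) + A(z_b, r/2; v) ≤ c (C^{2/3}(z_b, r; v) + C(z_b, r; v) +
D(z_b, r; q))` … Here, `z_b` and `r` satisfy conditions (as5)"; a consequence of the local energy
inequality of Def. 2.2, available by Remark 3.4). The constant `c` is generic (universal); `E` is
computed through any weak spatial gradient `G` of `u` on `Q`.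
[cite: SereginSverak2009, proof of Lemma 3.5, (as12)] -/
def LocalEnergyEstimate : Prop :=
  ∃ c : ℝ≥0, ∀ (u : ℝ → ℝ³ → ℝ³) (p : ℝ → ℝ³ → ℝ), IsAxisymmetricLocalSolution u p →
    IsTypeIOnCyl u → ∀ G : ℝ → ℝ³ → ℝ³ →L[ℝ] ℝ³, HasWeakSpatialGradientOn (parCylOpens 0 1) u G →
      ∀ b : ℝ, |b| ≤ 1 / 4 → ∀ r ∈ Ioo (0 : ℝ) (1 / 4),
        dissipationE ((0 : ℝ), b • eZ) (r / 2) G + energyA ((0 : ℝ), b • eZ) (r / 2) u ≤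
          c * (cubicC ((0 : ℝ), b • eZ) r u ^ (2 / 3 : ℝ) + cubicC ((0 : ℝ), b • eZ) r u +
            pressureD ((0 : ℝ), b • eZ) r p)

/-- **Seregin–Šverák 2009, proof of Lemma 3.5, (as13)** (arXiv p. 10: "and the decay estimate
for the pressure field `D(z_b, ϱ; q) ≤ c [ (ϱ/r) D(z_b, r; q) + (r/ϱ)² C(z_b, r; v) ]`. Here, `z_b`
and `r` satisfy conditions (as5) and `0 < ϱ ≤ r`"; the harmonic part of the pressure decays,
the rest is controlled by `|v|²` through Calderón–Zygmund). The constant `c` is generic.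
[cite: SereginSverak2009, proof of Lemma 3.5, (as13)] -/
def PressureDecay : Prop :=
  ∃ c : ℝ≥0, ∀ (u : ℝ → ℝ³ → ℝ³) (p : ℝ → ℝ³ → ℝ), IsAxisymmetricLocalSolution u p →
    IsTypeIOnCyl u → ∀ b : ℝ, |b| ≤ 1 / 4 → ∀ r ∈ Ioo (0 : ℝ) (1 / 4), ∀ ϱ ∈ Ioc (0 : ℝ) r,
      pressureD ((0 : ℝ), b • eZ) ϱ p ≤
        c * (ENNReal.ofReal (ϱ / r) * pressureD ((0 : ℝ), b • eZ) r p +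
          ENNReal.ofReal ((r / ϱ) ^ 2) * cubicC ((0 : ℝ), b • eZ) r u)

/-! ### Lemma 3.5 from its printed inputs -/

variable {u : ℝ → ℝ³ → ℝ³} {p : ℝ → ℝ³ → ℝ}

/-- (as13) in the form consumed by `decay_step`: `D(z, κ r) ≤ c (κ D(z, r) + κ⁻² C(z, r))` for
`0 < κ ≤ 1` (substitute `ϱ = κ r`). [cite: SereginSverak2009, proof of Lemma 3.5, (as13)] -/
theorem pressureD_mul_le_of_decay {c : ℝ≥0} {z : ℝ × ℝ³}
    (h13 : ∀ r ∈ Ioo (0 : ℝ) (1 / 4), ∀ ϱ ∈ Ioc (0 : ℝ) r,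
      pressureD z ϱ p ≤ c * (ENNReal.ofReal (ϱ / r) * pressureD z r p +
        ENNReal.ofReal ((r / ϱ) ^ 2) * cubicC z r u))
    {r : ℝ} (hr : r ∈ Ioo (0 : ℝ) (1 / 4)) {κ : ℝ≥0} (hκ : 0 < κ) (hκ1 : κ ≤ 1) :
    pressureD z ((κ : ℝ) * r) p ≤
      c * (κ * pressureD z r p + ((κ⁻¹ ^ 2 : ℝ≥0) : ℝ≥0∞) * cubicC z r u) := by
  have hκR : (0 : ℝ) < κ := by exact_mod_cast hκ
  have hκ1R : (κ : ℝ) ≤ 1 := by exact_mod_cast hκ1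
  have h := h13 r hr ((κ : ℝ) * r) ⟨mul_pos hκR hr.1, mul_le_of_le_one_left hr.1.le hκ1R⟩
  rwa [mul_div_cancel_right₀ _ hr.1.ne', ENNReal.ofReal_coe_nnreal,
    ofReal_div_mul_self_sq hκ hr.1] at h

/-- **Seregin–Šverák 2009, Lemma 3.5, from the printed inputs (as6), (as11), (as12), (as13).**
The proof is the printed iteration (arXiv p. 10): with `K` dominating the constants of (as12)
and (as13), choose `ϑ` with `(2K² + K)ϑ ≤ ½`, `4ϑ ≤ 1`, then `ε` with `(6K + K²)(2ϑ)⁻² ε ≤ ½`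
(both depend on `K` only); for a solution `(u, p)` take `G` from (as6) and `F = f₁(ε)` from
(as11); `decay_step_half` gives `ℰ_b(ϑ r) ≤ ½ ℰ_b(r) + f₃` for `ℰ_b = E + A + D` at
`z_b = (b e₃, 0)`, uniformly in `|b| ≤ 1/4`; on the top scales `ϑ/4 ≤ r < 1/4`, `ℰ_b(r)` is
bounded through `Q(z_b, r) ⊆ Q(0, 3/4) ⊆ Q` by (as6) and `‖q‖_{L^{3/2}(Q)}` (the monotonicity
lemmas `…_le_of_subset`); `iterate_halving` bounds `ℰ_b` on `(0, 1/4)`, and (as11) bounds `C`.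
[cite: SereginSverak2009, Lemma 3.5 and its proof (arXiv pp. 9–10)] -/
theorem ScaledEnergyBound.of_inputs (h6 : GradientEnergyBound) (h11 : CubicAbsorption)
    (h12 : LocalEnergyEstimate) (h13 : PressureDecay) : ScaledEnergyBound := by
  obtain ⟨c₁₂, h12⟩ := h12
  obtain ⟨c₁₃, h13⟩ := h13
  -- constants depending on `c₁₂, c₁₃` only
  set K : ℝ≥0 := max c₁₂ c₁₃ with hK
  have hK12 : (c₁₂ : ℝ≥0∞) ≤ K := ENNReal.coe_le_coe.2 (le_max_left _ _)
  have hK13 : (c₁₃ : ℝ≥0∞) ≤ K := ENNReal.coe_le_coe.2 (le_max_right _ _)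
  obtain ⟨ϑ, hϑ0, hϑ4, hKϑ⟩ := exists_ratio (2 * K ^ 2 + K)
  obtain ⟨ε, hε0, hKε⟩ := exists_parameter ((6 * K + K ^ 2) * (2 * ϑ)⁻¹ ^ 2)
  have hϑR : (0 : ℝ) < ϑ := by exact_mod_cast hϑ0
  have hϑR4 : 4 * (ϑ : ℝ) ≤ 1 := by exact_mod_cast hϑ4
  have hϑ1R : (ϑ : ℝ) < 1 := by linarith
  -- the solution
  intro u p hsol hI
  obtain ⟨G, hG, hfin⟩ := h6 u p hsol hI
  obtain ⟨F, hF⟩ := h11 u p hsol hI G hG ε hε0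
  refine ⟨G, hG, ?_⟩
  -- the top scales `r₀ ≤ r < 1/4`, `r₀ = ϑ/4`
  set r₀ : ℝ := (ϑ : ℝ) * (1 / 4) with hr₀
  have hr₀0 : 0 < r₀ := by positivity
  have hD₁ : pressureD 0 1 p < ∞ := by
    simpa [pressureD] using hsol.pressure_L32
  set M : ℝ≥0∞ := ENNReal.ofReal ((3 / 4) / r₀) * (energyA 0 (3 / 4) u + dissipationE 0 (3 / 4) G) +
    ENNReal.ofReal ((1 / r₀) ^ 2) * pressureD 0 1 p with hM
  have hMfin : M < ∞ := by
    refine ENNReal.add_lt_top.2 ⟨ENNReal.mul_lt_top ENNReal.ofReal_lt_top hfin,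
      ENNReal.mul_lt_top ENNReal.ofReal_lt_top hD₁⟩
  set B : ℝ≥0 := (6 * K + K ^ 2) * (2 * ϑ)⁻¹ ^ 2 * F + K * (2 * ϑ)⁻¹ ^ 2 with hB
  -- `ℰ_b ≤ M + 2B` on `(0, 1/4)`, uniformly in `|b| ≤ 1/4`
  have hΦ : ∀ b : ℝ, |b| ≤ 1 / 4 → ∀ r ∈ Ioo (0 : ℝ) (1 / 4),
      dissipationE ((0 : ℝ), b • eZ) r G + energyA ((0 : ℝ), b • eZ) r u +
        pressureD ((0 : ℝ), b • eZ) r p ≤ M + 2 * B := by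
    intro b hb r hr
    refine iterate_halving (Φ := fun r => dissipationE ((0 : ℝ), b • eZ) r G +
        energyA ((0 : ℝ), b • eZ) r u + pressureD ((0 : ℝ), b • eZ) r p)
      (R := 1 / 4) hϑR hϑ1R hr₀0 le_rfl ?_ ?_ hr.1 hr.2
    · -- the contraction `ℰ_b(ϑ r) ≤ ½ ℰ_b(r) + B`
      intro r hr0 hrR
      refine decay_step_half (E := fun r => dissipationE ((0 : ℝ), b • eZ) r G)
        (A := fun r => energyA ((0 : ℝ), b • eZ) r u)
        (C := fun r => cubicC ((0 : ℝ), b • eZ) r u)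
        (D := fun r => pressureD ((0 : ℝ), b • eZ) r p) hϑ0 hϑ4 hKϑ hKε (hF b hb)
        (fun r hr => (h12 u p hsol hI G hG b hb r hr).trans (by gcongr))
        (fun r hr κ hκ hκ1 =>
          (pressureD_mul_le_of_decay (h13 u p hsol hI b hb) hr hκ hκ1).trans (by gcongr))
        (fun r hr κ hκ hκ1 => cubicC_mul_le _ u hr.1 hκ hκ1) ⟨hr0, hrR⟩
    · -- the top scales, through `Q(z_b, r) ⊆ Q(0, 3/4) ⊆ Q`
      intro r h1 h2
      have hr0 : 0 < r := hr₀0.trans_le h1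
      have hbr : |b| + r ≤ 3 / 4 := by linarith
      have hbr1 : |b| + r ≤ 1 := by linarith
      have hsub := parCyl_axis_subset hr0.le hbr
      have hsub1 := parCyl_axis_subset hr0.le hbr1
      have hE : dissipationE ((0 : ℝ), b • eZ) r G ≤
          ENNReal.ofReal ((3 / 4) / r₀) * dissipationE 0 (3 / 4) G :=
        (dissipationE_le_of_subset hr0 (by norm_num) hsub).trans (by gcongr)
      have hA : energyA ((0 : ℝ), b • eZ) r u ≤
          ENNReal.ofReal ((3 / 4) / r₀) * energyA 0 (3 / 4) u := by
        have ht : Ioo (((0 : ℝ), b • eZ).1 - r ^ 2) ((0 : ℝ), b • eZ).1 ⊆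
            Ioo ((0 : ℝ × ℝ³).1 - (3 / 4) ^ 2) (0 : ℝ × ℝ³).1 := by
          refine Ioo_subset_Ioo ?_ le_rfl
          simp only [Prod.fst_zero]
          nlinarith
        have hx : spaceCyl ((0 : ℝ), b • eZ).2 r ⊆ spaceCyl (0 : ℝ × ℝ³).2 (3 / 4) :=
          spaceCyl_axis_subset hbr
        exact (energyA_le_of_subset hr0 (by norm_num) ht hx).trans (by gcongr)
      have hD : pressureD ((0 : ℝ), b • eZ) r p ≤
          ENNReal.ofReal ((1 / r₀) ^ 2) * pressureD 0 1 p :=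
        (pressureD_le_of_subset hr0 (by norm_num) hsub1).trans (by gcongr)
      calc dissipationE ((0 : ℝ), b • eZ) r G + energyA ((0 : ℝ), b • eZ) r u +
            pressureD ((0 : ℝ), b • eZ) r p
          ≤ ENNReal.ofReal ((3 / 4) / r₀) * dissipationE 0 (3 / 4) G +
            ENNReal.ofReal ((3 / 4) / r₀) * energyA 0 (3 / 4) u +
            ENNReal.ofReal ((1 / r₀) ^ 2) * pressureD 0 1 p := add_le_add (add_le_add hE hA) hD
        _ = M := by rw [hM]; ring
  -- conclusion: `A + E + C + D ≤ (M + 2B) + (ε (M + 2B) + F) =: C₁`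
  have hT : M + 2 * B + (ε * (M + 2 * B) + F) ≠ ∞ := by
    have hMB : M + 2 * B ≠ ∞ := ENNReal.add_ne_top.2 ⟨hMfin.ne, by finiteness⟩
    exact ENNReal.add_ne_top.2 ⟨hMB, ENNReal.add_ne_top.2 ⟨ENNReal.mul_ne_top (by finiteness) hMB,
      by finiteness⟩⟩
  refine ⟨(M + 2 * B + (ε * (M + 2 * B) + F)).toNNReal, fun b hb r hr => ?_⟩
  rw [ENNReal.coe_toNNReal hT]
  have h1 := hΦ b hb r hr
  have h2 := hF b hb r hr
  calc energyA ((0 : ℝ), b • eZ) r u + dissipationE ((0 : ℝ), b • eZ) r G +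
        cubicC ((0 : ℝ), b • eZ) r u + pressureD ((0 : ℝ), b • eZ) r p
      = (dissipationE ((0 : ℝ), b • eZ) r G + energyA ((0 : ℝ), b • eZ) r u +
          pressureD ((0 : ℝ), b • eZ) r p) + cubicC ((0 : ℝ), b • eZ) r u := by ring
    _ ≤ (M + 2 * B) + (ε * (dissipationE ((0 : ℝ), b • eZ) r G +
          energyA ((0 : ℝ), b • eZ) r u) + F) := add_le_add h1 h2
    _ ≤ (M + 2 * B) + (ε * (M + 2 * B) + F) := by
        have hEA : dissipationE ((0 : ℝ), b • eZ) r G + energyA ((0 : ℝ), b • eZ) r u ≤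
            M + 2 * B := le_self_add.trans h1
        gcongr (M + 2 * (B : ℝ≥0∞)) + ((ε : ℝ≥0∞) * ?_ + (F : ℝ≥0∞))

end SereginSverak2009

end Literature.Analysis.FluidPDE
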